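import Summits.CriticalPhenomena.SAWScalingLimit.Theses.SAWTrackTransport
import Summits.CriticalPhenomena.SAWScalingLimit.Theses.SAWZoomRigidity
import Literature.Probability.RandomPlanarGeometry.ZoomFlow
import Literature.Probability.RandomPlanarGeometry.SLEConvergenceCriterion

/-!
# Sketch — crux idea `zoom-invariant-limit-set` for `SAWTrackTransport.YBLimitExists`
(stmt-CriticalPhenomena-16995), ideator 1, round 1.

First lemmas of the line, over existing declarations:

* `meshFaces_image_dil` — the discretisation of the Glazman–Manolescu tiling is EXACTLY dilation
  invariant: `(r • Ω)_{r δ} = Ω_δ` as sets of faces (PROVED here).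
* `IsYBRobustSubseqLimit P s` / `ybSubseqLimitSet` — the set `Ω_YB` of ROBUST joint subsequential
  limit families of the critical square-tiling Yang–Baxter walk (all Dobrushin domains, all sub-mesh
  shifts `‖u δ‖ ≤ δ`, all admissible mid-edge endpoints — the binders of the crux's own `RL (π/2)`).
* `ZoomInvariantYBLimitSet` — FIRST LEMMA (statement): `Ω_YB` is invariant under the zoom flow
  `ChordalFamily.zoom r`, `r > 0` (YB twin of the PROVED δℤ² support `ZoomInvariantLimitSet`,
  stmt-CriticalPhenomena-6503).
* `JointCompactnessYB`, `LineShape` — the intended composition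
  `JointCompactnessYB → SubseqAxiomsYB → SubseqRotationYB → ZoomRigidity (6500) → RStarRot (7298)
  → YBLimitExists`, with the two continuum stubs the EXISTING shared items.
-/

namespace Summit.CriticalPhenomena.SAWScalingLimit.Cruxes.YBLimitExists.ZoomInvariantLimitSet

open MeasureTheory Filter Topology
open Literature.Probability.RandomPlanarGeometry
open Literature.Probability.RandomPlanarGeometry.SAW.YangBaxter

/-- The square tiling: all column angles `π/2`. -/
noncomputable abbrev sq : ℤ → ℝ := fun _ => Real.pi / 2

/-- **Exact dilation invariance of the discretisation**: the faces of `(r • Ω)` at mesh `r δ` are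
the faces of `Ω` at mesh `δ` (`r > 0`). The YB analogue of `meshDomain_image_similarity`
(Theorems/SAWZoomRigidityZoomInvariantLimitSet.lean). -/
theorem meshFaces_image_dil (Θ : ℤ → ℝ) {r : ℝ} (hr : 0 < r) (Ω : Set ℂ) (δ : ℝ) :
    meshFaces Θ ((fun z : ℂ => (r : ℂ) * z) '' Ω) (r * δ) = meshFaces Θ Ω δ := by
  have hr' : (r : ℂ) ≠ 0 := Complex.ofReal_ne_zero.2 hr.ne'
  ext f
  simp only [mem_meshFaces_iff, Set.mem_image]
  refine forall₂_congr fun z _ => ⟨?_, ?_⟩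
  · rintro ⟨w, hw, h⟩
    have : w = (δ : ℂ) * z := by
      apply mul_left_cancel₀ hr'
      rw [h]; push_cast; ring
    simpa [this] using hw
  · intro h
    exact ⟨(δ : ℂ) * z, h, by push_cast; ring⟩

/-- `P` is a ROBUST joint subsequential scaling limit of the critical square-tiling Yang–Baxter walk
along the mesh sequence `s` (positive, `→ 0`): for every Dobrushin domain and every admissible
robust family `(u, a, b)` (the binders of the crux's `RL (π/2)`), the curve laws at mesh `s n`
converge weakly to `P D`. -/
def IsYBRobustSubseqLimit (P : ChordalFamily) (s : ℕ → ℝ) : Prop :=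
  (∀ n, 0 < s n) ∧ Tendsto s atTop (𝓝 0) ∧
  ∀ (D : DobrushinDomain) (u : ℝ → ℂ) (a b : ℝ → MidEdge),
    (∀ᶠ δ in 𝓝[>] (0 : ℝ), ‖u δ‖ ≤ δ) →
    (∀ᶠ δ in 𝓝[>] (0 : ℝ), Nonempty (YangBaxterSAW sq
      ((D.map (similarity 1 one_ne_zero (u δ))).carrier) δ (a δ) (b δ))) →
    Tendsto (fun δ : ℝ => (δ : ℂ) * planeMidpoint sq (a δ)) (𝓝[>] (0 : ℝ)) (𝓝 (D.pt 0)) →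
    Tendsto (fun δ : ℝ => (δ : ℂ) * planeMidpoint sq (b δ)) (𝓝[>] (0 : ℝ)) (𝓝 (D.pt 1)) →
    ∀ f : BoundedContinuousFunction (CurveClass ℂ) ℝ,
      Tendsto (fun n => ∫ γ, f (γ.curve sq (s n))
        ∂(ybLaw sq ((D.map (similarity 1 one_ne_zero (u (s n)))).carrier) (s n) 1 (a (s n)) (b (s n))))
        atTop (𝓝 (∫ x, f x ∂(P D)))

/-- `Ω_YB`: the set of chordal robust joint subsequential limit families of the YB walk. -/
def ybSubseqLimitSet : Set ChordalFamily :=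
  {P | P.IsChordal ∧ ∃ s : ℕ → ℝ, IsYBRobustSubseqLimit P s}

/-- **FIRST LEMMA of the line** (YB twin of the PROVED `ZoomInvariantLimitSet`, stmt-6503):
`Ω_YB` is invariant under the zoom (mesh) flow — exact lattice dilation: the walk of `(r • D)` at
mesh `r δ` IS `r ·` the walk of `D` at mesh `δ` (`meshFaces_image_dil`), the sub-mesh bound
`‖u δ‖ ≤ δ` and the endpoint convergence transport along `δ ↦ δ / r`. -/
def ZoomInvariantYBLimitSet : Prop :=
  ∀ P ∈ ybSubseqLimitSet, ∀ r : ℝ, 0 < r → P.zoom r ∈ ybSubseqLimitSet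

/-- JOINT COMPACTNESS of the YB laws (twin of stmt-6502): (a) every positive null mesh sequence has
a subsequence carrying a robust joint limit; (b) `Ω_YB` is sequentially compact domainwise. Engine:
canonical tightness (CompassSLE `YBTight`) + a uniform-in-δ modulus of continuity of the law in
`(D, a, b)` (restriction squeeze + boundary non-crawling + endpoint screening) + diagonal
extraction; the same modulus makes `Ω_YB` CONNECTED (limit set of an asymptotically continuous
one-parameter family). -/
def JointCompactnessYB : Prop :=
  (∀ s : ℕ → ℝ, (∀ n, 0 < s n) → Tendsto s atTop (𝓝 0) →
    ∃ φ : ℕ → ℕ, StrictMono φ ∧ ∃ P ∈ ybSubseqLimitSet, IsYBRobustSubseqLimit P (s ∘ φ)) ∧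
  (∀ v : ℕ → ChordalFamily, (∀ n, v n ∈ ybSubseqLimitSet) →
    ∃ P ∈ ybSubseqLimitSet, ∃ φ : ℕ → ℕ, StrictMono φ ∧
      ∀ (D : DobrushinDomain) (f : BoundedContinuousFunction (CurveClass ℂ) ℝ),
        Tendsto (fun n => ∫ γ, f γ ∂(v (φ n) D)) atTop (𝓝 (∫ γ, f γ ∂(P D))))

/-- Rotation covariance of the elements of `Ω_YB` (the route's track-transport engine applied
along mesh SEQUENCES: DKKMO-type coupling + the reflection trick; optional if R* (stmt-1368, D4
form) is used instead of `RStarRot`). -/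
def SubseqRotationYB : Prop :=
  ∀ P ∈ ybSubseqLimitSet, ∀ (D : DobrushinDomain) (c : ℂ) (hc : c ≠ 0), ‖c‖ = 1 →
    P (D.map (similarity c hc 0)) = (P D).map (CurveClass.map (similarity c hc 0 : C(ℂ, ℂ)))

/-- The intended COMPOSITION of the line (shape only; `SubseqAxiomsYB` = "every element of `Ω_YB`
is NICE", the hypothesis clause of `SAWZoomRigidity.ZoomRigidity`, left abstract here). -/
def LineShape (SubseqAxiomsYB : Prop) : Prop :=
  ZoomInvariantYBLimitSet → JointCompactnessYB → SubseqAxiomsYB → SubseqRotationYB →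
    Theses.SAWZoomRigidity.ZoomRigidity → Theses.SAWTrackTransport.RStarRot →
    Theses.SAWTrackTransport.YBLimitExists

end Summit.CriticalPhenomena.SAWScalingLimit.Cruxes.YBLimitExists.ZoomInvariantLimitSet
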